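import Literature.AnabelianGeometry.AbsoluteAnabelian.AbsTopI.RelativeGCInputs
import Literature.AnabelianGeometry.AbsoluteAnabelian.AbsTopIII.KummerFaithfulGenSubpadicProofs
import Literature.AnabelianGeometry.AbsoluteAnabelian.SubpadicGaloisSlim
import HarnessLib

/-!
# [AbsTopI] Example 4.8 (i): the named fact `Ex_4_8_i` IS its scheme-side + GC clauses (residual
# form), and its universal closure over ALL interfaces `𝒟` is refuted at a toy class (F-0193)

Proof-only companion of `AbsTopI/RelativeGC.lean` (abc-iut-L4-t13, p407449) and `AbsTopI/RelativeGCInputs.lean`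
(p409985); both imported, never edited.  S. Mochizuki, *Topics in Absolute Anabelian Geometry I*
[AbsTopI], Example 4.8 (i) p. 58: "The hypotheses of Theorem 4.7, (i), (ii), are satisfied relative to
this `𝒟`.  Indeed, it is immediate that `𝒟` is chain-full; the rel-isom-DGC follows from [Tpcs],
Theorem 4.12; the prime `p` clearly serves as a prime '`l`' [...] the absolute Galois group of a
generalized sub-`p`-adic field is always slim."  Cell abc-iut, block F (fact-proving wave), seat
abc-iut-f-056, FACT-LIST tranche 56, row **F-0193 `AbsTopI.ConstructionDataClass.Ex_4_8_i`**.

* RESIDUAL FORM (`ex_4_8_i_iff`): since the two FIELD-SIDE clauses of the typed fact are kernel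
  theorems (`cyclotomic_of_isEx48ClassGen`, `slim_of_isEx48ClassGen`, abc-iut-L4-t13 / L4-d1), the
  named fact `𝒟.Ex_4_8_i p` is EQUIVALENT to "`IsEx48ClassGen p 𝒟 → 𝒟.IsChainFull ∧ 𝒟.RelIsomDGC`",
  i.e. to exactly its scheme-side clause ("it is immediate that `𝒟` is chain-full") and its GC clause
  ([Tpcs] Thm 4.12, typed as `Tpcs.Thm_4_12`; on curve members `relIsomGC_curves_of_thm_4_12`).
* UNIVERSAL CLOSURE REFUTED (`exists_isEx48ClassGen_not_isChainFull`, `not_forall_ex_4_8_i`): the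
  interface `ConstructionDataClass` records "the `(X_j, k_j)` occurring in `X̃/X`-chains" as the bare
  datum `chainTerms` (only the étale-`π₁` instance can fill it in), so over ALL interfaces the
  chain-fullness clause fails: WITNESS DATA (not a class of curves) with one base field
  `Frac W(𝔽̄_p)` (generalized sub-`p`-adic, `isGeneralizedSubpadicFor_fracWitt`), two "objects" of
  which one is flagged a hyperbolic orbicurve (= member) and one is not, no morphisms, trivial groups
  `G = G`, and `chainTerms ≡ everything` — a chain from the member reaches the non-member.
  Consequence of record: F-0193 is consumable only AT A NAMED CLASS `𝒟` (as `cor_3_4_of_ex_4_8_i`,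
  `cor_3_7_of_ex_4_8_i`, … do, hypothesis `hEx`), where it amounts to chain-fullness + [Tpcs] Thm 4.12
  of that class; neither is available from Mathlib (no étale `π₁`), both stay named inputs.

HONEST FRAMING: statements about OUR typed interface, not about print's Example 4.8; typed ≠ proved; no
class of curves is asserted to exist; nothing here bears on [IUTchIII] Cor. 3.12; no side taken.
-/

noncomputable section

namespace Literature.AnabelianGeometry.AbsoluteAnabelian.AbsTopI

open Literature.AlgebraicGeometry.Frobenioids (IsSlimGroup)

universe u

namespace ConstructionDataClass

variable {𝒟 : ConstructionDataClass.{u}}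

/-! ### Residual form of the named fact -/

/-- **[AbsTopI] Example 4.8 (i), RESIDUAL FORM**: the named fact `Ex_4_8_i` holds for a class `𝒟` iff,
granted that `𝒟` is the Example-4.8 (i) class (`IsEx48ClassGen p`), `𝒟` is chain-full and satisfies the
rel-isom-DGC — the cyclotomic clause ("`p` serves as `l`") and the slimness clause ([Tpcs] Lem 4.14)
being kernel theorems for generalized sub-`p`-adic fields. [cite: MochizukiAbsTopI2012, Ex 4.8 (i) p.58] -/
theorem ex_4_8_i_iff {p : ℕ} [Fact p.Prime] :
    𝒟.Ex_4_8_i p ↔ (𝒟.IsEx48ClassGen p → 𝒟.IsChainFull ∧ 𝒟.RelIsomDGC) := by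
  constructor
  · intro h h𝒟
    exact ⟨(h h𝒟).1, (h h𝒟).2.1⟩
  · intro h h𝒟
    exact ⟨(h h𝒟).1, (h h𝒟).2, cyclotomic_of_isEx48ClassGen h𝒟, slim_of_isEx48ClassGen h𝒟⟩

/-- For an Example-4.8 (i) class, `Ex_4_8_i` says exactly: chain-full and rel-isom-DGC.
[cite: MochizukiAbsTopI2012, Ex 4.8 (i) p.58] -/
theorem ex_4_8_i_iff_of_isEx48ClassGen {p : ℕ} [Fact p.Prime] (h𝒟 : 𝒟.IsEx48ClassGen p) :
    𝒟.Ex_4_8_i p ↔ 𝒟.IsChainFull ∧ 𝒟.RelIsomDGC :=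
  ex_4_8_i_iff.trans ⟨fun h => h h𝒟, fun h _ => h⟩

/-- For an Example-4.8 (i) class all of whose members are hyperbolic CURVES, `Ex_4_8_i` follows from
chain-fullness and [Tpcs] Thm 4.12 field by field, and conversely yields chain-fullness (the printed
inputs, with the field-side clauses discharged). [cite: MochizukiAbsTopI2012, Ex 4.8 (i) p.58] -/
theorem ex_4_8_i_iff_isChainFull_of_thm_4_12 {p : ℕ} [Fact p.Prime] (h𝒟 : 𝒟.IsEx48ClassGen p)
    (hcurve : ∀ b X, 𝒟.Mem b X → (𝒟.datum b).IsHyperbolicCurve X)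
    (hGC : ∀ b, Tpcs.Thm_4_12 p (𝒟.fld b) (𝒟.datum b)) :
    𝒟.Ex_4_8_i p ↔ 𝒟.IsChainFull :=
  ⟨fun h => (h h𝒟).1, fun hfull => ex_4_8_i_of_thm_4_12' hfull hcurve hGC⟩

end ConstructionDataClass

/-! ### The universal closure over all interfaces is false -/

/-- **WITNESS DATA for F-0193** (not a class of curves): for every prime `p`, an interface
`𝒟 : ConstructionDataClass` which IS an Example-4.8 (i) class in the typed sense (`IsEx48ClassGen p`:
its one base field `Frac W(𝔽̄_p)` is generalized sub-`p`-adic, `p ∈ Σ = Primes`, members = the objects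
flagged hyperbolic orbicurves) but is NOT chain-full: it has two "objects", a member and a non-member,
and its bare datum `chainTerms` ("the `X_j, k_j` appearing in an `X̃/X`-chain", which only the étale
`π₁` could supply) lists the non-member as a chain term of the member.
[cite: MochizukiAbsTopI2012, Ex 4.8 (i) p.58] -/
theorem exists_isEx48ClassGen_not_isChainFull (p : ℕ) [Fact p.Prime] :
    ∃ 𝒟 : ConstructionDataClass.{0}, 𝒟.IsEx48ClassGen p ∧ ¬ 𝒟.IsChainFull := by
  let K : Type := FractionRing (WittVector p (AlgebraicClosure (ZMod p)))
  have hK : AbsTopIII.IsGeneralizedSubpadicFor K p := AbsTopIII.isGeneralizedSubpadicFor_fracWitt p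
  haveI : CharZero K := hK.charZero
  let A : AugmentedProfiniteGrp (absoluteGaloisGrp K) :=
    ⟨absoluteGaloisGrp K, ContinuousMonoidHom.id _, Function.surjective_id⟩
  let D : RelativeAnabelianDatum (absoluteGaloisGrp K) :=
    { Obj := Bool
      Hom := fun _ _ => PEmpty
      IsIso := fun f => f.elim
      IsHyperbolicCurve := fun X => X = true
      primes := Set.univ
      grp := fun _ => A
      outerHom := fun f => f.elim }
  let 𝒟 : ConstructionDataClass.{0} :=
    { Base := PUnit
      fld := fun _ => K
      instField := fun _ => inferInstance
      instCharZero := fun _ => inferInstance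
      datum := fun _ => D
      Mem := fun _ X => X = true
      IsHyperbolicOrbicurve := fun _ X => X = true
      isHyperbolicOrbicurve_of_isHyperbolicCurve := fun _ _ h => h
      chainTerms := fun _ _ => Set.univ }
  refine ⟨𝒟, ⟨fun _ => hK, fun _ => Set.mem_univ p, fun _ _ => Iff.rfl⟩, fun hfull => ?_⟩
  have h := (hfull PUnit.unit true rfl ⟨PUnit.unit, false⟩ (Set.mem_univ _)).1
  exact Bool.false_ne_true h

/-- **FACT-LIST F-0193, universal closure REFUTED** (universe `0`): for every prime `p` the named
fact `Ex_4_8_i p` FAILS for the witness interface of `exists_isEx48ClassGen_not_isChainFull`.  So the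
row [AbsTopI] Example 4.8 (i) is consumable only AT A NAMED CLASS `𝒟` (hypothesis `hEx` of
`cor_3_4_of_ex_4_8_i`, `cor_3_7_of_ex_4_8_i`, …), where by `ex_4_8_i_iff` it amounts to the
chain-fullness of that class + [Tpcs] Thm 4.12 for it; this refutes OUR `∀ 𝒟`-reading of a shape-(M)
schema, not print's Example 4.8 (i). [cite: MochizukiAbsTopI2012, Ex 4.8 (i) p.58] -/
theorem not_forall_ex_4_8_i (p : ℕ) [Fact p.Prime] :
    ¬ ∀ 𝒟 : ConstructionDataClass.{0}, 𝒟.Ex_4_8_i p := by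
  intro h
  obtain ⟨𝒟, h𝒟, hfull⟩ := exists_isEx48ClassGen_not_isChainFull p
  exact hfull (h 𝒟 h𝒟).1

end Literature.AnabelianGeometry.AbsoluteAnabelian.AbsTopI
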